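/-
Copyright (c) 2026. All rights reserved.
Released under Apache 2.0 license as described in the file LICENSE.
Authors: abc-iut cell, prover seat abc-iut-w6-d074 (gen 5).
-/
import Literature.AnabelianGeometry.AbsoluteAnabelian.AbsTopIThm26vFullTransportProofs
import Literature.AnabelianGeometry.AbsoluteAnabelian.AbsTopILem27iiiStepOfSigmaStarCorollaries
import Literature.AnabelianGeometry.AbsoluteAnabelian.AbsTopIThm26SigmaStarAlmostProCorollaries
import HarnessLib

/-!
# [AbsTopI] Theorem 2.6 (v) ⇒ "`Δ ⊆ Π` is group-theoretic", from (∗)_Σ at EVERY `Σ ⊆ Primes`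

S. Mochizuki, *Topics in Absolute Anabelian Geometry I: Generalities*, J. Math. Sci. Univ. Tokyo 19
(2012) [MochizukiAbsTopI2012], Thm 2.6 (v) p. 22 (manuscript pagination, lit key
`paper:url-11ac98ba15fc`): the subgroup `Δ ⊆ Π` "may be characterized ["group-theoretically"]" via
`ζ̃`; consumed downstream in the shape "every isomorphism of topological groups `Π_E ⥲ Π_F` carries
`Δ_E` onto `Δ_F`" (`PreservesGeom`, [AbsAnab] Lemma 1.3.8; cited [IUTchI] p. 73, [IUTchII] pp. 35, 71).

PROOF-ONLY companion (no definitions) for the cone node `AbsTopI:Thm2.6(v)` (K4 RE-CLOSE, plan C-R33):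
the node's indexed closers `preservesGeom_of_thm26v` / `preservesGeom_of_coinvariantRankConstant`
take the typed statement `Thm26v` (FACT F-0249) resp. `CoinvariantRankConstant` (F-0001) as
HYPOTHESES, both of which have refuted universal closures.  Here the same conclusion `PreservesGeom α`
is re-closed against the SURVIVING instance form: the inputs are print's — MLF base data `G ≅ G_K`,
Prop 2.2 (`GeomTFG`), `Π` topologically finitely generated, `Δ` pro-`Σ` (resp. ALMOST pro-`Σ`), the
extension split over an open subgroup of `G`, and condition (∗)_Σ of the proof of Thm 2.6 (ii)
(`SigmaStarCondition`, abc-iut-w6-d074 gen 2) — for ARBITRARY `Σ_E, Σ_F ⊆ Primes` (the two sides may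
even use different `Σ`), by composing abc-iut-w6-d074 gen 3's
`MLFBase.thm26vFull_of_sigmaStarCondition(_of_isAlmostPro)` (general-`Θ` form `Thm26vFull`, every
`Σ ⊆ Primes`, Lemma 2.7 (iii) step discharged in kernel) with abc-iut-L4-t15's transport
`preservesGeom_of_thm26vFull`.  The `Σ = Primes` case from print's (∗) and the zero-hypothesis
instances at the split free models `F̂_n × G_K ↠ G_K` are already in the tree
(`preservesGeom_of_starCondition`, `preservesGeom_split_profiniteCompletion_freeGroup`) and are not
restated.  Refereed pre-IUT anabelian geometry; nothing here bears on the disputed [IUTchIII]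
Cor. 3.12; typed ≠ proved; (∗)_Σ / splitting remain hypotheses on the extension datum.
-/

set_option autoImplicit false

noncomputable section

namespace Literature.AnabelianGeometry.AbsoluteAnabelian

namespace FundamentalExtension

variable {E F : FundamentalExtension.{0}}

/-- **[AbsTopI] Thm 2.6 (v) ⇒ `Δ` is preserved by EVERY isomorphism of topological groups
`α : Π_E ⥲ Π_F`**, for two extensions with MLF base data, each satisfying Prop 2.2 (`GeomTFG`), `Π`
topologically finitely generated, `Δ` pro-`Σ`, split over an open subgroup of `G`, and (∗)_Σ — for
arbitrary `Σ_E, Σ_F ⊆ Primes`.  (`Thm26vFull` on both sides via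
`MLFBase.thm26vFull_of_sigmaStarCondition`, then `preservesGeom_of_thm26vFull`.)
[cite: MochizukiAbsTopI2012, Thm 2.6 (v) p.22] -/
theorem MLFBase.preservesGeom_of_sigmaStarCondition (BE : E.MLFBase) (BF : F.MLFBase)
    (SE SF : Set ℕ) (hSE : SE ⊆ {q | q.Prime}) (hSF : SF ⊆ {q | q.Prime})
    (hΔE : E.GeomTFG) (htfgE : IsTopologicallyFinitelyGenerated E.arith)
    (hΔSE : IsProSet E.geom SE) (hsE : E.SplitsOverOpenSubgroup) (hstarE : E.SigmaStarCondition SE)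
    (hΔF : F.GeomTFG) (htfgF : IsTopologicallyFinitelyGenerated F.arith)
    (hΔSF : IsProSet F.geom SF) (hsF : F.SplitsOverOpenSubgroup) (hstarF : F.SigmaStarCondition SF)
    (α : E.arith ≃ₜ* F.arith) : PreservesGeom α :=
  preservesGeom_of_thm26vFull
    (MLFBase.thm26vFull_of_sigmaStarCondition BE SE hSE hΔE htfgE hΔSE hsE hstarE)
    (MLFBase.thm26vFull_of_sigmaStarCondition BF SF hSF hΔF htfgF hΔSF hsF hstarF) α

/-- The same with `Δ` only ALMOST pro-`Σ` on each side (print's construction datum, [AbsTopI] Def 2.1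
(i) / p. 17: "geometrically almost pro-Σ"), via
`MLFBase.thm26vFull_of_sigmaStarCondition_of_isAlmostPro`. [cite: MochizukiAbsTopI2012, Thm 2.6 (v) p.22] -/
theorem MLFBase.preservesGeom_of_sigmaStarCondition_of_isAlmostPro (BE : E.MLFBase) (BF : F.MLFBase)
    (SE SF : Set ℕ) (hSE : SE ⊆ {q | q.Prime}) (hSF : SF ⊆ {q | q.Prime})
    (hΔE : E.GeomTFG) (htfgE : IsTopologicallyFinitelyGenerated E.arith)
    (hΔSE : IsAlmostPro E.geom SE) (hsE : E.SplitsOverOpenSubgroup) (hstarE : E.SigmaStarCondition SE)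
    (hΔF : F.GeomTFG) (htfgF : IsTopologicallyFinitelyGenerated F.arith)
    (hΔSF : IsAlmostPro F.geom SF) (hsF : F.SplitsOverOpenSubgroup) (hstarF : F.SigmaStarCondition SF)
    (α : E.arith ≃ₜ* F.arith) : PreservesGeom α :=
  preservesGeom_of_thm26vFull
    (MLFBase.thm26vFull_of_sigmaStarCondition_of_isAlmostPro BE SE hSE hΔE htfgE hΔSE hsE hstarE)
    (MLFBase.thm26vFull_of_sigmaStarCondition_of_isAlmostPro BF SF hSF hΔF htfgF hΔSF hsF hstarF) α

/-- The same with "`Π` tfg" supplied from Prop 2.2 (`GeomTFG`) and "`G` tfg" on each side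
(`MLFBase.thm26vFull_of_sigmaStarCondition_of_isAlmostPro_of_geomTFG`).
[cite: MochizukiAbsTopI2012, Thm 2.6 (v) p.22] -/
theorem MLFBase.preservesGeom_of_sigmaStarCondition_of_isAlmostPro_of_geomTFG (BE : E.MLFBase)
    (BF : F.MLFBase) (SE SF : Set ℕ) (hSE : SE ⊆ {q | q.Prime}) (hSF : SF ⊆ {q | q.Prime})
    (hΔE : E.GeomTFG) (hGE : IsTopologicallyFinitelyGenerated E.gal)
    (hΔSE : IsAlmostPro E.geom SE) (hsE : E.SplitsOverOpenSubgroup) (hstarE : E.SigmaStarCondition SE)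
    (hΔF : F.GeomTFG) (hGF : IsTopologicallyFinitelyGenerated F.gal)
    (hΔSF : IsAlmostPro F.geom SF) (hsF : F.SplitsOverOpenSubgroup) (hstarF : F.SigmaStarCondition SF)
    (α : E.arith ≃ₜ* F.arith) : PreservesGeom α :=
  preservesGeom_of_thm26vFull
    (MLFBase.thm26vFull_of_sigmaStarCondition_of_isAlmostPro_of_geomTFG BE SE hSE hΔE hGE hΔSE hsE
      hstarE)
    (MLFBase.thm26vFull_of_sigmaStarCondition_of_isAlmostPro_of_geomTFG BF SF hSF hΔF hGF hΔSF hsF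
      hstarF) α

/-- Self-form: under the same inputs on ONE extension, `Δ` is carried onto itself by every
automorphism of the topological group `Π` (the hypothesis shape `∀ φ, PreservesGeom φ` of the
[AbsAnab] Lemma 1.3.8 / [AbsTopII] Rmk 3.3.2 consumers). [cite: MochizukiAbsTopI2012, Thm 2.6 (v) p.22] -/
theorem MLFBase.geom_map_eq_self_of_sigmaStarCondition (B : E.MLFBase) (S : Set ℕ)
    (hS : S ⊆ {q | q.Prime}) (hΔ : E.GeomTFG) (htfg : IsTopologicallyFinitelyGenerated E.arith)
    (hΔS : IsProSet E.geom S) (hs : E.SplitsOverOpenSubgroup) (hstar : E.SigmaStarCondition S)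
    (φ : E.arith ≃ₜ* E.arith) : E.geom.map φ.toMulEquiv.toMonoidHom = E.geom :=
  geom_map_eq_self_of_thm26vFull
    (MLFBase.thm26vFull_of_sigmaStarCondition B S hS hΔ htfg hΔS hs hstar) φ

/-- **`Σ = Primes` from print's (∗) ([AbsAnab] Lemma 1.1.4 (ii) hypotheses) in the GENERAL-`Θ`
route**: MLF base data, splitting, Prop 2.2, (∗), `Π` tfg on both sides ⇒ `PreservesGeom α` — the
sibling of abc-iut-L4-t15's `preservesGeom_of_starCondition` (which goes through the typed `Θ = {1}`
form `Thm26v` and asks `Δ` tfg instead of Prop 2.2 + `Π` tfg).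
[cite: MochizukiAbsTopI2012, Thm 2.6 (v) p.22] -/
theorem MLFBase.preservesGeom_of_starCondition_of_geomTFG (BE : E.MLFBase) (BF : F.MLFBase)
    (hsE : E.SplitsOverOpenSubgroup) (hΔE : E.GeomTFG) (hstarE : E.StarCondition)
    (htfgE : IsTopologicallyFinitelyGenerated E.arith)
    (hsF : F.SplitsOverOpenSubgroup) (hΔF : F.GeomTFG) (hstarF : F.StarCondition)
    (htfgF : IsTopologicallyFinitelyGenerated F.arith)
    (α : E.arith ≃ₜ* F.arith) : PreservesGeom α :=
  preservesGeom_of_thm26vFull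
    (MLFBase.thm26vFull_of_starCondition_of_splits BE hsE hΔE hstarE htfgE)
    (MLFBase.thm26vFull_of_starCondition_of_splits BF hsF hΔF hstarF htfgF) α

end FundamentalExtension

end Literature.AnabelianGeometry.AbsoluteAnabelian

end
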